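import Summits.SmoothPoincare4.SmoothPoincare4.Theorems.EntropyRungBakryEmeryLogSobolevGaffneyCutoff
import Summits.SmoothPoincare4.SmoothPoincare4.Theorems.EntropyRungNoncompactShrinkerGapHeatEntropyCutoff
import HarnessLib

/-!
# The time derivative of the cut-off entropy with a first-order (Gaffney) cut-off
# (support item `EntropyRung.BakryEmeryLogSobolev`, stmt-SmoothPoincare4-16587)

Setting: `M` modelled on `ℝⁿ` (Hausdorff, second countable, `T₃`, Borel — NOT compact), `g` Riemannian with
its Levi-Civita connection, `V` smooth (NO further assumption), `L = Δ_g − g⁻¹(dV, d·)`.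

`entropyCutoffSq_le` — **de Bruijn's identity with a cut-off, first-order version**: for a positive `u` smooth
on `M × S` with `∂ₜu = Lu` within `S`, a smooth compactly supported cut-off `η` with `|η| ≤ 1` and
`|∇η|² ≤ δ²`, and a slice with `a ≤ u(t) ≤ b` (`a > 0`), `|∇u(t)|² ≤ C_G`, at `t ∈ S`:

  `|∫ η² ∂ₜ(u log u e^{-V}) + ∫ η² |∇u|²/u e^{-V}| ≤ 2 (1 + Λ) δ √C_G ∫ e^{-V}`,
  `Λ = max(|log a|, |log b|)`:

`∂ₜ(u log u) = (1 + log u) Lu`; the weighted Green identity against the compactly supported factor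
`(1 + log u) η²` (`integral_mul_cutoffSq_mul_weightedLaplacian`) gives
`∫η²(1+log u)(Lu)e^{-V} = −∫η² |∇u|²/u e^{-V} − 2∫(1+log u) η g⁻¹(dη, du) e^{-V}`, and
`|(1+log u) η g⁻¹(dη, du)| ≤ (1+Λ) δ √C_G`. Compare the shrinker toolkit's `entropyCutoff_eq` (error
`∫ u log u (Lη) e^{-V}`, which needs `|Lη| ≤ C`). Everything is proved; no definitions, no named facts.

## References

* [BakryGentilLedoux2014] D. Bakry, I. Gentil, M. Ledoux (2014), Prop. 5.7.1 (p. 268, proof: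
  `d/dt Ent(P_t f) = −I(P_t f)`) with §3.2 (pp. 141–147: cut-offs `ζ_k`, `Γ(ζ_k) ≤ 1/k`).
* [CarrilloNi2009] J. A. Carrillo, L. Ni, Comm. Anal. Geom. 17 (2009), §3 (3.2).
-/

noncomputable section

set_option linter.dupNamespace false

open scoped Manifold ContDiff ENNReal NNReal Topology
open MeasureTheory Set Filter
open Literature.Geometry.Lorentzian Literature.Geometry.Riemannian

namespace Summit.SmoothPoincare4.SmoothPoincare4.Theorems.BakryEmeryComplete

open NoncompactShrinkerGapHeat

section Entropy

variable {n : ℕ} {M : Type*} [TopologicalSpace M] [T2Space M] [SecondCountableTopology M]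
  [ChartedSpace (EuclideanSpace ℝ (Fin n)) M] [IsManifold (𝓡 n) ∞ M] [T3Space M] [MeasurableSpace M]
  [BorelSpace M]
  {g : PseudoRiemannianMetric (𝓡 n) ∞ (EuclideanSpace ℝ (Fin n)) (TangentSpace (𝓡 n) : M → Type _)}
  [g.HasLeviCivita]

/-- **de Bruijn's identity with a first-order cut-off** (see the module docstring): at `t ∈ S`,
`|∫ η² ∂ₜ(u log u e^{-V}) + ∫ η² |∇u|²/u e^{-V}| ≤ 2(1 + Λ) δ √C_G ∫ e^{-V}`, `Λ = max(|log a|, |log b|)`.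
[cite: BakryGentilLedoux2014, Prop. 5.7.1 (proof, p. 268) with §3.2 (pp. 141–147)]
[cite: CarrilloNi2009, §3 (3.2)] -/
theorem entropyCutoffSq_le (hg : g.IsRiemannian) {V : M → ℝ} (hV : ContMDiff (𝓡 n) 𝓘(ℝ, ℝ) ∞ V)
    (hw : Integrable (fun y ↦ Real.exp (-V y)) g.riemVolume)
    {u : ℝ → M → ℝ} {S : Set ℝ} (hS : UniqueDiffOn ℝ S)
    (hu : ContMDiffOn ((𝓡 n).prod 𝓘(ℝ, ℝ)) 𝓘(ℝ, ℝ) ∞ (fun p : M × ℝ ↦ u p.2 p.1) (univ ×ˢ S))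
    (heq : ∀ t ∈ S, ∀ y : M, derivWithin (fun s ↦ u s y) S t =
      g.dalembertian (u t) y
        - g.innerDual y (mvfderiv (𝓡 n) V y).toLinearMap (mvfderiv (𝓡 n) (u t) y).toLinearMap)
    {η : M → ℝ} (hη : ContMDiff (𝓡 n) 𝓘(ℝ, ℝ) ∞ η) (hηc : HasCompactSupport η) (hη1 : ∀ y, |η y| ≤ 1)
    {δ : ℝ} (hδ : 0 ≤ δ) (hηgrad : ∀ y, g.gradSq η y ≤ δ ^ 2)
    {t : ℝ} (ht : t ∈ S) {a b CG : ℝ} (ha : 0 < a) (hab : ∀ y, a ≤ u t y ∧ u t y ≤ b)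
    (hG : ∀ y, g.gradSq (u t) y ≤ CG) :
    |(∫ y, η y ^ 2 * derivWithin (fun s ↦ u s y * Real.log (u s y) * Real.exp (-V y)) S t ∂g.riemVolume)
      + ∫ y, η y ^ 2 * (g.gradSq (u t) y / u t y * Real.exp (-V y)) ∂g.riemVolume| ≤
      2 * (1 + max |Real.log a| |Real.log b|) * δ * Real.sqrt CG * ∫ y, Real.exp (-V y) ∂g.riemVolume := by
  haveI := CarrilloNi2009_shrinkerLSI.isFiniteMeasureOnCompacts_riemVolume hg
  have h1le : (1 : ℕ∞ω) ≤ (∞ : ℕ∞ω) := WithTop.coe_le_coe.mpr le_top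
  set μ : Measure M := g.riemVolume with hμ
  -- the slice at time `t` and its regularity
  have hF : ContMDiff (𝓡 n) 𝓘(ℝ, ℝ) ∞ (u t) :=
    hu.comp_contMDiff (contMDiff_id.prodMk contMDiff_const) fun y ↦ ⟨mem_univ _, ht⟩
  have hpt : ∀ y, 0 < u t y := fun y ↦ ha.trans_le (hab y).1
  have hlogF : ContMDiff (𝓡 n) 𝓘(ℝ, ℝ) ∞ (fun y ↦ Real.log (u t y)) := fun y ↦
    ((Real.contDiffAt_log.2 (hpt y).ne').contMDiffAt).comp y (hF y)
  have hA : ContMDiff (𝓡 n) 𝓘(ℝ, ℝ) ∞ (fun y ↦ 1 + Real.log (u t y)) := contMDiff_const.add hlogF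
  -- the pointwise time derivative: `∂ₜ(u log u e^{-V}) = (1 + log u)(Lu) e^{-V}`
  have hfd : ∀ y, HasDerivWithinAt (fun s ↦ u s y) (derivWithin (fun s ↦ u s y) S t) S t := fun y ↦
    hasDerivWithinAt_time_of_contMDiffOn (by simp) hu y ht
  have hprod : ∀ y, derivWithin (fun s ↦ u s y * Real.log (u s y) * Real.exp (-V y)) S t =
      (1 + Real.log (u t y)) * (g.dalembertian (u t) y
        - g.innerDual y (mvfderiv (𝓡 n) V y).toLinearMap (mvfderiv (𝓡 n) (u t) y).toLinearMap)
        * Real.exp (-V y) := by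
    intro y
    have hl : HasDerivWithinAt (fun s ↦ Real.log (u s y))
        ((u t y)⁻¹ * derivWithin (fun s ↦ u s y) S t) S t := by
      have := (Real.hasDerivAt_log (hpt y).ne').comp_hasDerivWithinAt t (hfd y)
      simpa [Function.comp_def] using this
    have hm : HasDerivWithinAt (fun s ↦ u s y * Real.log (u s y))
        (derivWithin (fun s ↦ u s y) S t * Real.log (u t y)
          + u t y * ((u t y)⁻¹ * derivWithin (fun s ↦ u s y) S t)) S t := (hfd y).mul hl
    have h : derivWithin (fun s ↦ u s y * Real.log (u s y) * Real.exp (-V y)) S t =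
        (derivWithin (fun s ↦ u s y) S t * Real.log (u t y)
          + u t y * ((u t y)⁻¹ * derivWithin (fun s ↦ u s y) S t)) * Real.exp (-V y) :=
      (hm.mul_const (Real.exp (-V y))).derivWithin (hS t ht)
    have key : u t y * ((u t y)⁻¹ * derivWithin (fun s ↦ u s y) S t) = derivWithin (fun s ↦ u s y) S t := by
      rw [← mul_assoc, mul_inv_cancel₀ (hpt y).ne', one_mul]
    rw [h, key, heq t ht y]
    ring
  -- the Green identity against `(1 + log u) η²`
  have hid := integral_mul_cutoffSq_mul_weightedLaplacian hg (a := fun y ↦ 1 + Real.log (u t y)) hA hF hη hηc hV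
  have hFd : ∀ y, MDifferentiableAt (𝓡 n) 𝓘(ℝ, ℝ) (u t) y := fun y ↦ hF.mdifferentiableAt (by simp)
  have hdA : ∀ y, g.innerDual y (mvfderiv (𝓡 n) (fun z ↦ 1 + Real.log (u t z)) y).toLinearMap
      (mvfderiv (𝓡 n) (u t) y).toLinearMap = g.gradSq (u t) y / u t y := by
    intro y
    have hlogd : MDifferentiableAt (𝓡 n) 𝓘(ℝ, ℝ) (fun z ↦ Real.log (u t z)) y := hlogF.mdifferentiableAt (by simp)
    have e1 : (mvfderiv (𝓡 n) (fun z ↦ 1 + Real.log (u t z)) y).toLinearMap =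
        (mvfderiv (𝓡 n) (fun z ↦ Real.log (u t z)) y).toLinearMap := by
      rw [mvfderiv_fun_add mdifferentiableAt_const hlogd, mvfderiv_const, zero_add]
    rw [e1, innerDual_mvfderiv_log_left (hFd y) (hpt y)]
    have : g.innerDual y (mvfderiv (𝓡 n) (u t) y).toLinearMap (mvfderiv (𝓡 n) (u t) y).toLinearMap =
        g.gradSq (u t) y := rfl
    rw [this, div_eq_inv_mul]
  -- continuity, integrability
  have hWc : Continuous fun y ↦ Real.exp (-V y) := Real.continuous_exp.comp hV.continuous.neg
  have hηcont : Continuous η := hη.continuous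
  have hη2c : HasCompactSupport (fun y ↦ η y ^ 2) := by
    rw [show (fun y ↦ η y ^ 2) = fun y ↦ η y * η y from funext fun y ↦ sq (η y)]
    exact hηc.mul_right
  have hAc : Continuous fun y ↦ 1 + Real.log (u t y) := hA.continuous
  have hIηF : Continuous fun y ↦ g.innerDual y (mvfderiv (𝓡 n) η y).toLinearMap
      (mvfderiv (𝓡 n) (u t) y).toLinearMap := continuous_innerDual_mvfderiv g (hη.of_le h1le) (hF.of_le h1le)
  have hQc : Continuous fun y ↦ g.gradSq (u t) y / u t y :=
    (contMDiff_gradSq g hF).continuous.div hF.continuous fun y ↦ (hpt y).ne'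
  -- (i) the left integral equals `∫ (1 + log u) η² (Lu) e^{-V}`
  have e0 : ∫ y, η y ^ 2 * derivWithin (fun s ↦ u s y * Real.log (u s y) * Real.exp (-V y)) S t ∂μ =
      ∫ y, (1 + Real.log (u t y)) * η y ^ 2 * (g.dalembertian (u t) y
        - g.innerDual y (mvfderiv (𝓡 n) V y).toLinearMap (mvfderiv (𝓡 n) (u t) y).toLinearMap) *
        Real.exp (-V y) ∂μ :=
    integral_congr_ae (Eventually.of_forall fun y ↦ by dsimp only; rw [hprod y]; ring)
  -- (ii) the first Green term is the cut-off Fisher information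
  have e1 : ∫ y, η y ^ 2 * g.innerDual y (mvfderiv (𝓡 n) (fun z ↦ 1 + Real.log (u t z)) y).toLinearMap
      (mvfderiv (𝓡 n) (u t) y).toLinearMap * Real.exp (-V y) ∂μ =
      ∫ y, η y ^ 2 * (g.gradSq (u t) y / u t y * Real.exp (-V y)) ∂μ :=
    integral_congr_ae (Eventually.of_forall fun y ↦ by dsimp only; rw [hdA y]; ring)
  -- (iii) the error term is bounded pointwise
  set Λ : ℝ := max |Real.log a| |Real.log b| with hΛ
  have hCG0 : ∀ y : M, 0 ≤ CG := fun y ↦ (g.gradSq_nonneg hg _ y).trans (hG y)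
  have hlogbd : ∀ y, |1 + Real.log (u t y)| ≤ 1 + Λ := by
    intro y
    have h := abs_add_le (1 : ℝ) (Real.log (u t y))
    rw [abs_one] at h
    have h2 : |Real.log (u t y)| ≤ Λ := by
      rw [abs_le]
      constructor
      · have h3 : Real.log a ≤ Real.log (u t y) := Real.log_le_log ha (hab y).1
        linarith [neg_abs_le (Real.log a), le_max_left |Real.log a| |Real.log b|]
      · have h3 : Real.log (u t y) ≤ Real.log b := Real.log_le_log (hpt y) (hab y).2
        linarith [le_abs_self (Real.log b), le_max_right |Real.log a| |Real.log b|]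
    linarith
  have herr : ∀ y, |(1 + Real.log (u t y)) * η y * g.innerDual y (mvfderiv (𝓡 n) η y).toLinearMap
      (mvfderiv (𝓡 n) (u t) y).toLinearMap * Real.exp (-V y)| ≤ (1 + Λ) * δ * Real.sqrt CG * Real.exp (-V y) := by
    intro y
    have hI := abs_innerDual_le_sqrt_gradSq_mul hg η (u t) y
    have h2 : Real.sqrt (g.gradSq η y) ≤ δ := by rw [← Real.sqrt_sq hδ]; exact Real.sqrt_le_sqrt (hηgrad y)
    have h3 : Real.sqrt (g.gradSq (u t) y) ≤ Real.sqrt CG := Real.sqrt_le_sqrt (hG y)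
    have hI' : |g.innerDual y (mvfderiv (𝓡 n) η y).toLinearMap (mvfderiv (𝓡 n) (u t) y).toLinearMap| ≤
        δ * Real.sqrt CG := hI.trans (mul_le_mul h2 h3 (Real.sqrt_nonneg _) hδ)
    rw [abs_mul, abs_mul, abs_mul, abs_of_nonneg (Real.exp_pos _).le]
    have hW0 : 0 ≤ Real.exp (-V y) := (Real.exp_pos _).le
    calc |1 + Real.log (u t y)| * |η y| *
          |g.innerDual y (mvfderiv (𝓡 n) η y).toLinearMap (mvfderiv (𝓡 n) (u t) y).toLinearMap| * Real.exp (-V y)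
        ≤ (1 + Λ) * 1 * (δ * Real.sqrt CG) * Real.exp (-V y) := by
          refine mul_le_mul_of_nonneg_right ?_ hW0
          exact mul_le_mul (mul_le_mul (hlogbd y) (hη1 y) (abs_nonneg _) (by positivity)) hI'
            (abs_nonneg _) (by positivity)
      _ = (1 + Λ) * δ * Real.sqrt CG * Real.exp (-V y) := by ring
  have iErr : Integrable (fun y ↦ (1 + Real.log (u t y)) * η y * g.innerDual y
      (mvfderiv (𝓡 n) η y).toLinearMap (mvfderiv (𝓡 n) (u t) y).toLinearMap * Real.exp (-V y)) μ :=
    integrable_of_continuous_of_hasCompactSupport' hg (((hAc.mul hηcont).mul hIηF).mul hWc)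
      (((hηc.mul_left).mul_right).mul_right)
  have hEbd : |∫ y, (1 + Real.log (u t y)) * η y * g.innerDual y (mvfderiv (𝓡 n) η y).toLinearMap
      (mvfderiv (𝓡 n) (u t) y).toLinearMap * Real.exp (-V y) ∂μ| ≤ (1 + Λ) * δ * Real.sqrt CG *
        ∫ y, Real.exp (-V y) ∂μ := by
    calc |∫ y, (1 + Real.log (u t y)) * η y * g.innerDual y (mvfderiv (𝓡 n) η y).toLinearMap
          (mvfderiv (𝓡 n) (u t) y).toLinearMap * Real.exp (-V y) ∂μ|
        ≤ ∫ y, |(1 + Real.log (u t y)) * η y * g.innerDual y (mvfderiv (𝓡 n) η y).toLinearMap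
          (mvfderiv (𝓡 n) (u t) y).toLinearMap * Real.exp (-V y)| ∂μ := abs_integral_le_integral_abs
      _ ≤ ∫ y, (1 + Λ) * δ * Real.sqrt CG * Real.exp (-V y) ∂μ :=
          integral_mono iErr.abs (hw.const_mul _) herr
      _ = (1 + Λ) * δ * Real.sqrt CG * ∫ y, Real.exp (-V y) ∂μ := integral_const_mul _ _
  -- conclusion
  rw [e0, hid, e1]
  have e2 : -(∫ y, η y ^ 2 * (g.gradSq (u t) y / u t y * Real.exp (-V y)) ∂μ)
      - 2 * ∫ y, (1 + Real.log (u t y)) * η y * g.innerDual y (mvfderiv (𝓡 n) η y).toLinearMap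
          (mvfderiv (𝓡 n) (u t) y).toLinearMap * Real.exp (-V y) ∂μ
      + ∫ y, η y ^ 2 * (g.gradSq (u t) y / u t y * Real.exp (-V y)) ∂μ =
      -2 * ∫ y, (1 + Real.log (u t y)) * η y * g.innerDual y (mvfderiv (𝓡 n) η y).toLinearMap
          (mvfderiv (𝓡 n) (u t) y).toLinearMap * Real.exp (-V y) ∂μ := by ring
  rw [e2, abs_mul, show |(-2 : ℝ)| = 2 by norm_num]
  linarith [hEbd]

end Entropy

end Summit.SmoothPoincare4.SmoothPoincare4.Theorems.BakryEmeryComplete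

end
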